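import Literature.MathematicalPhysics.QuantumFieldTheory.Balaban1983to89.T4HistoryPeeling

/-!
# T4InsertionProfile — row T4-U5.E-a2* (self-proposed continuation of T4-U5.E-a under the yield clause): the
SINGLE-SLOT conditional ratio bound of `T4HistoryPeeling.SlotDom` SPLIT into ENERGY × ENTROPY — a POINTWISE,
context-uniform insertion ratio priced by the SHAPE of the inserted structure (the unprinted heart, one term against
one term), an INSERTION PROFILE (injectivity of context × shape), and a SHAPE-ENTROPY budget (counting only) — with the
kernel bookkeeping that recombines them, the doubly graded entropy arithmetic (events × volume) fed by the tree's
lattice-animal count, and the independent-structure sanity model (cell `pub-balaban`, T4-DAG v5 §5/§6 node U5 / NE7b;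
estimate cell EST: typed located hypothesis with constants + kernel bookkeeping; the estimate itself is NOT kernel-proved
and NOT printed — see below)

HONEST FRAMING (cell `pub-balaban`, T4-DAG PAGE 1).  The cell's T4 target is the existence AND uniqueness of the
continuum limit of Bałaban's unit-scale averaged loop expectations on a FIXED finite torus — strictly beyond ultraviolet
stability ([Balaban1989LargeFieldII] Thm 1 p. 355); it is NOT the Yang–Mills mass gap and NOT the Clay problem.  This
module serves ONE clause of the cell's own uniqueness spine (node U5c, persistent-activity weight bound NE7b, in the
single-slot form of `T4HistoryPeeling`).  Nothing of Bałaban's is asserted: every «…» below was READ BY THIS SEAT ON THE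
RENDERED JOURNAL PAGE (PNG ×2) and is quoted for CONTEXT, SHAPE AND LOCATION ONLY; the new hypothesis shapes
(`PointwiseRatio`, `InjOnFibres`, `PointDom`, §1–§2) are consumed only as hypotheses and are flagged NOT PRINTED.  Value =
typed located hypothesis + kernel bookkeeping, NOT an estimate of Bałaban's expansion, NOT summit progress.

CITATION HEADER.
* [Balaban1989LargeFieldII] = T. Bałaban, *Large field renormalization. II. Localization, exponentiation, and bounds for
  the ℝ operation*, Commun. Math. Phys. **122** (1989) 355–392 (cell paper B16; PDF page = journal page − 354; renders
  `b2b-balaban-ref1/pages/1989-cmp122-large-field-II/1989-cmp122-large-field-II-pNNN-x2.png`, NNN = PDF page; the four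
  pages below were read by this seat on the renders p029, p030, p033, p036).
  p. 383 [p029], the SMALL FACTOR PER CREATION: «This is the largest factor among all the small factors we have obtained
  from the large field characteristic functions in the preparatory steps. We assume that 2p₁ − (d + 5)r₀ > p₀, and we
  estimate the factors by exp(−p₀(g_j)).»; the COUPLING and COUNTING factors: «The integrals with respect to the fields
  A_j in (2.21) [III], or (1.25) [IV], are estimated using the positivity properties of the quadratic forms, and we get
  the factors exp O(1)|Z_j ∩ Ω_j|, where the volume is for the corresponding scale. Finally, the summations over the
  admissible sequences can be replaced by the factors exp O(1)(MR_j)^{−d}|Z_j|.»; and the summary bound (1.79):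
  «T′_k(X)1 ≤ sup exp{Σ_{j=1}^{k} O(1)M^dR_j^{d+1}d′_j(Z_j)} · ∏_{j=1}^{k} ∏_i exp(−½γ₀A₁²p₀²(g_j)(d′_j(Z_j^{(i)}) + 1)
  − 2p₀(g_j)) ∏′ exp(−p₀(g_j)), (1.79) where the last product is over components of Z_j satisfying the conditions (i),
  (ii), for which some large fields are created during the preparatory steps.» (a growth factor and a decay factor, both
  EXPONENTIAL IN THE SIZE `d′_j` of the large-field components, and one small factor per creation — the printed TYPE of
  the shape price of §3: `ρ^{#events} · λ^{#cubes}`).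
  p. 384 [p030], SIZE and SHRINKING: «d′_n(S^{n−j}(Z)) ≤ (63)^d(MR_n)^{−d}|Z^{(n−j)}| ≤ (63)^d 3·2^{d−1}d′_n(Z^{(n−j)}) if
  the linear size on the right-hand side is different from 0» and «d′_n(Z^{(n−j)}) ≤ L^{−1/2(n−j)}d′_j(Z) ≤
  2^{−(n−j)}d′_j(Z)» (an old region seen from a later scale has shrunk geometrically — the cell's reason why the
  attachment entropy of later events is affordable, §3 docstrings; reading, not assertion).
  p. 387 [p033] (1.89): «T′_k(X)1 ≤ exp(−2(1 + β₀)^{−1}p₀(g_k)). (1.89)» and «hence also an improved bound (1.89), with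
  the additional term −κ₁d_k(X) in the exponential.»
  p. 390 [p036] (1.99)–(1.101): «|R′^{(k)}(X,(U,J))| ≤ O(1)c₁ exp(−(1 + ½β)κd_{k,∪Y_i}(X)). (1.99) The exponentiation
  (1.98) completes the R-operation.» … «|R′^{(k)}(X,(U,J))| ≤ exp(−p₀(g_k)) exp(−κd_k(X)). (1.100)» … «A_k(1/(g_k(·))²,
  U_k) = A′_k(1/(g_k(·))², U_k) + Σ_X R′^{(k)}(X, U_k) + Σ_X B′^{(k)}(X, U_k). (1.101)» (what a deleted structure changes
  in its context: the small-field action, the ℝ-terms and the boundary terms B′^{(k)} near it — the locus of the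
  CONTEXT-UNIFORMITY demanded by (EN) below).
  WHAT THESE PAGES DO NOT PRINT (and this module does NOT assert): (EN) a POINTWISE, CONTEXT-UNIFORM insertion ratio
  "weight of a history with one more pending structure of shape `s` ≤ y(s) × weight of the same history without it",
  valid in every frozen context and through all later renormalization steps up to the cutoff; (INS) that a history is
  determined by its context and the shape of the deleted structure; (ENT) that the shape prices of one slot sum to the
  slot activity of `T4HistoryPeeling` §4.  (1.79)/(1.89) are sup-bounds on `T′_k(X)1` for ONE operation, not ratio bounds
  in a frozen environment; the passage from the one to the other is the cell's NE7b at its most primitive clause (E2-en of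
  record t4/T4-EST-U5Ea2.md), located here and consumed only as `(h : PointwiseRatio …)` / `(h : PointDom …)`.
* [King1986] = C. King, Commun. Math. Phys. **102** (1986) 649–677, (3.10)–(3.11) p. 656 — the printed MODEL of
  "matched part + large-field complement bounded by weight" (quoted in `T4WeightBudget`); CONTEXT ONLY.

THE POINT.  `T4HistoryPeeling.SlotDom.dom` ends in the single-slot clause
`∀ i, ∀ τ″ ∈ T K, pend i τ″ = false → Σ_{τ ∈ T K : pend i τ ∧ off i τ = τ″} A K t τ ≤ x i · A K t τ″` — a bound of a
FIBRE SUM (all ways of inserting one pending structure at slot `i` into the frozen context `τ″`) by the context's own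
weight.  Every Peierls / cluster-expansion argument proves such a clause the same way, and this module makes that way the
TYPE: §1 (INS) an INSERTION PROFILE `shape i : ι → σ` injective on each fibre (`InjOnFibres`; automatic when a history can
be RECONSTRUCTED from context and shape, `injOnFibres_of_reconstruct`), (EN) the POINTWISE RATIO `A τ ≤ y i (shape i τ) ·
A (off i τ)` for pending `τ` (`PointwiseRatio` — ONE term against ONE term, the price depending on the shape only, NOT on
the context: this is where the context-uniformity / failure mode (F1) of row U5.E-a now lives, isolated from all
counting), (ENT) the SHAPE ENTROPY `Σ_{s ∈ Sh i} y i s ≤ x i` over a context-free catalogue `Sh i ∋ shape i τ` of shapes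
with prices `y ≥ 0` ⇒ the single-slot clause (`single_slot_of_pointwise`; kernel: `Finset.sum_image` on the fibre, then
monotonicity).  The fibre-restricted form `single_slot_of_pointwise_fibre` (entropy summed only over the shapes realised
over `τ″`) is FAITHFUL — for positive weights the single-slot clause gives it back with the tautological profile
(`injOnFibres_id`, `pointwiseRatio_self`, `fibreEntropy_of_single_slot`) — so the whole unprinted content of the clause
is the passage from context-dependent to CONTEXT-FREE prices.  §2 packages (INS)+(EN)+(ENT) per `(K, t)` as `PointDom σ l₀
T A Bad S` with `PointDom.toSlotDom` (hence `toPeierlsDom`, `bad_le`, `relWeightBound_of_pointDom`,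
`relWeightBound_of_pointDom_twoRate` binder-for-binder with `T4HistoryPeeling`).  §3 is the ENTROPY ARITHMETIC that
discharges (ENT) from counting of the printed type: shapes doubly graded by an EVENT count `m s ≥ m₀` (R2 of
`T4HistoryPeeling` §4) and a VOLUME `v s ≥ v₀` (cubes of all regions of the structure, `v₀ = 1`), prices
`y s ≤ ρ^{m s} · λ^{v s}` (R1 «exp(−p₀(g_j))» per event; per cube the net of the decay and growth factors of (1.79)), and
the joint count `#{s : m s = k, v s = w} ≤ Γ^k · C^w` («exp O(1)(MR_j)^{−d}|Z_j|»: exponential in the volume; per event a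
constant, into which the attachment entropy of renewals and mergers goes — affordable by the shrinking of p. 384 and by
`C^w`, cell reading) ⇒ `Σ_s y s ≤ (Γρ)^{m₀}/(1 − Γρ) · (Cλ)^{v₀}/(1 − Cλ)` (`gradedShapeSum_le`; kernel: fibrewise over the
pair of grades, `Finset.sum_product`, two geometric tails `T4WeightBudget.sum_pow_le_of_le`), which is
`T4HistoryPeeling.recordSum_le`'s `(Γρ)^{m₀}/(1 − Γρ)` times a λ-small constant and feeds `pow_eventCount_le_twoRate` /
`slotBudget_le` unchanged; the volume-count TYPE is the tree's lattice-animal theorem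
(`Literature.Probability.LatticeModels.card_connectedFamily_le`: at most `(Δ+1)^{2(w−1)}` connected cell sets of `w` cells
through a given cell), restated as `card_animals_filter_le`, and the merger-tree count is Catalan `≤ 4^e`
(`card_mergerTrees_le`, Mathlib).  §4 SANITY: the independent-structure model of `T4HistoryPeeling` §5 carries the
ONE-POINT profile (`σ = Unit`, price `u K i`) with (EN) an EQUALITY, so `PointDom` is inhabited non-trivially
(`pointDom_product`) and (INS) is literally "a pattern with slot `i` on is its switch-off plus one bit".

Sources.  [Balaban1989LargeFieldII] pp. 383–390 — CONTEXT / LOCATION ONLY as above; [King1986] (3.10) — CONTEXT ONLY.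
Everything proved below is elementary finite combinatorics and real analysis. [folklore]
Unit `b2b-balaban-pv14` gen 6 (journal CLAIM T4-U5.E-a2* 2026-08-18T23:50:47Z); imports `T4HistoryPeeling` (row
T4-U5.E-a, this lineage gen 5) and through it `T4PeierlsDomination` / `T4WeightBudgetKP` / `T4WeightBudget` and
`Literature.Probability.LatticeModels.PolymerGasGeometric` / `LatticeAnimals`.
-/

open Finset _root_.Filter _root_.Topology

namespace Literature.MathematicalPhysics.QuantumFieldTheory.Balaban1983to89.T4InsertionProfile

open T4HybridMatching T4CauchySum T4Crossover T4WeightBudget T4WeightBudgetKP T4PeierlsDomination T4HistoryPeeling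
open Literature.Probability.LatticeModels (IsRConnected card_connectedFamily_le)

/-! ## §1 The energy × entropy split of the single-slot bound -/

section Split

variable {ι : Type*} {T : Finset ι} {n : ℕ} {σ : Type*}

/-- **(INS) INSERTION PROFILE (HYPOTHESIS SHAPE; a modelling constraint on the choice of `shape`, NOT PRINTED).**  The
shape map of slot `i` separates the fibres of `off i`: two pending terms with the same context `off i τ` and the same
shape are equal.  Cell reading: `shape i τ` = the combinatorial type of the pending structure of `τ` anchored at slot `i`
(its regions at all scales as cell sets relative to the anchor, its renewal / merger record); a large-field history is its
context plus that structure, so (INS) holds by reconstruction (`injOnFibres_of_reconstruct`). [folklore] -/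
def InjOnFibres (Φ : SwitchOff T n) (shape : Fin n → ι → σ) : Prop :=
  ∀ i : Fin n, ∀ τ₁ ∈ T, ∀ τ₂ ∈ T, Φ.pend i τ₁ = true → Φ.pend i τ₂ = true → Φ.off i τ₁ = Φ.off i τ₂ →
    shape i τ₁ = shape i τ₂ → τ₁ = τ₂

/-- **(EN) POINTWISE CONTEXT-UNIFORM INSERTION RATIO (HYPOTHESIS SHAPE; NOT PRINTED, NOT ASSERTED — the cell's NE7b at
its most primitive clause, E2-en).**  For every pending term `τ` of slot `i`: `A τ ≤ y i (shape i τ) · A (off i τ)` — ONE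
term against ONE term, the price `y i s` depending on the slot and the SHAPE ONLY, not on the context `off i τ` (other
structures present or not; the small-field action, the ℝ-terms and the boundary terms B′^{(k)} of (1.101) p. 390 near the
structure all change when it is deleted, at every later step up to the cutoff).  The printed sup-bounds (1.79) p. 383 /
(1.89) p. 387 on `T′_k(X)1` are bounds for ONE operation applied to `1`, not this ratio. [folklore] -/
def PointwiseRatio (Φ : SwitchOff T n) (A : ι → ℝ) (shape : Fin n → ι → σ) (y : Fin n → σ → ℝ) : Prop :=
  ∀ i : Fin n, ∀ τ ∈ T, Φ.pend i τ = true → A τ ≤ y i (shape i τ) * A (Φ.off i τ)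

/-- (INS) from RECONSTRUCTION: if inserting the shape of `τ` into the context of `τ` gives `τ` back, the profile is
injective on fibres. [folklore] -/
theorem injOnFibres_of_reconstruct (Φ : SwitchOff T n) (shape : Fin n → ι → σ) (ins : Fin n → ι → σ → ι)
    (hins : ∀ i, ∀ τ ∈ T, Φ.pend i τ = true → ins i (Φ.off i τ) (shape i τ) = τ) : InjOnFibres Φ shape := by
  intro i τ₁ h₁ τ₂ h₂ hp₁ hp₂ hoff hsh
  calc τ₁ = ins i (Φ.off i τ₁) (shape i τ₁) := (hins i τ₁ h₁ hp₁).symm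
    _ = ins i (Φ.off i τ₂) (shape i τ₂) := by rw [hoff, hsh]
    _ = τ₂ := hins i τ₂ h₂ hp₂

/-- **ENERGY × ENTROPY ⇒ THE SINGLE-SLOT BOUND, fibre-restricted form.**  Non-negative weights, (INS), (EN), and the
entropy of the shapes REALISED over each context `τ″` bounded by `x i` ⇒ the single-slot clause of `SlotDom.dom`
(`Finset.sum_image` on the fibre: distinct terms of one fibre have distinct shapes). [folklore] -/
theorem single_slot_of_pointwise_fibre [DecidableEq ι] [DecidableEq σ] (Φ : SwitchOff T n) {A : ι → ℝ}
    {x : Fin n → ℝ} {shape : Fin n → ι → σ} {y : Fin n → σ → ℝ} (hA : ∀ τ ∈ T, 0 ≤ A τ)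
    (hinj : InjOnFibres Φ shape) (hen : PointwiseRatio Φ A shape y)
    (hent : ∀ i : Fin n, ∀ τ'' ∈ T, Φ.pend i τ'' = false →
      ∑ s ∈ (T.filter fun τ => Φ.pend i τ = true ∧ Φ.off i τ = τ'').image (shape i), y i s ≤ x i) :
    ∀ i : Fin n, ∀ τ'' ∈ T, Φ.pend i τ'' = false →
      ∑ τ ∈ T with (Φ.pend i τ = true ∧ Φ.off i τ = τ''), A τ ≤ x i * A τ'' := by
  intro i τ'' hτ'' hp
  have hinjF : Set.InjOn (shape i) ↑(T.filter fun τ => Φ.pend i τ = true ∧ Φ.off i τ = τ'') := by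
    intro a ha b hb h
    simp only [Finset.coe_filter, Set.mem_setOf_eq] at ha hb
    exact hinj i a ha.1 b hb.1 ha.2.1 hb.2.1 (ha.2.2.trans hb.2.2.symm) h
  calc ∑ τ ∈ T with (Φ.pend i τ = true ∧ Φ.off i τ = τ''), A τ
      ≤ ∑ τ ∈ T with (Φ.pend i τ = true ∧ Φ.off i τ = τ''), y i (shape i τ) * A τ'' := by
        refine Finset.sum_le_sum fun τ hτ => ?_
        obtain ⟨hτT, hpτ, hoff⟩ := Finset.mem_filter.1 hτ
        have h := hen i τ hτT hpτ
        rwa [hoff] at h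
    _ = (∑ τ ∈ T with (Φ.pend i τ = true ∧ Φ.off i τ = τ''), y i (shape i τ)) * A τ'' := by
        rw [Finset.sum_mul]
    _ = (∑ s ∈ (T.filter fun τ => Φ.pend i τ = true ∧ Φ.off i τ = τ'').image (shape i), y i s) * A τ'' := by
        rw [Finset.sum_image hinjF]
    _ ≤ x i * A τ'' := mul_le_mul_of_nonneg_right (hent i τ'' hτ'' hp) (hA τ'' hτ'')

/-- **ENERGY × ENTROPY ⇒ THE SINGLE-SLOT BOUND (the E2 split).**  Non-negative weights; (INS) `InjOnFibres`; a
context-free shape catalogue `Sh i ∋ shape i τ` for pending `τ` with prices `y i ≥ 0` on it; (EN) `PointwiseRatio`; (ENT)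
`Σ_{s ∈ Sh i} y i s ≤ x i` ⇒ `Σ_{τ : pend i τ, off i τ = τ″} A τ ≤ x i · A τ″` for every slot `i` and every context
`τ″ ∈ T` with `pend i τ″ = false` — literally the last clause of `T4HistoryPeeling.SlotDom.dom`. [folklore] -/
theorem single_slot_of_pointwise [DecidableEq ι] [DecidableEq σ] (Φ : SwitchOff T n) {A : ι → ℝ}
    {x : Fin n → ℝ} {shape : Fin n → ι → σ} {y : Fin n → σ → ℝ} {Sh : Fin n → Finset σ} (hA : ∀ τ ∈ T, 0 ≤ A τ)
    (hinj : InjOnFibres Φ shape) (hrange : ∀ i, ∀ τ ∈ T, Φ.pend i τ = true → shape i τ ∈ Sh i)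
    (hy : ∀ i, ∀ s ∈ Sh i, 0 ≤ y i s) (hen : PointwiseRatio Φ A shape y) (hent : ∀ i, ∑ s ∈ Sh i, y i s ≤ x i) :
    ∀ i : Fin n, ∀ τ'' ∈ T, Φ.pend i τ'' = false →
      ∑ τ ∈ T with (Φ.pend i τ = true ∧ Φ.off i τ = τ''), A τ ≤ x i * A τ'' := by
  refine single_slot_of_pointwise_fibre Φ hA hinj hen fun i τ'' _ _ => ?_
  calc ∑ s ∈ (T.filter fun τ => Φ.pend i τ = true ∧ Φ.off i τ = τ'').image (shape i), y i s
      ≤ ∑ s ∈ Sh i, y i s :=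
        Finset.sum_le_sum_of_subset_of_nonneg
          (fun s hs => by
            obtain ⟨τ, hτ, rfl⟩ := Finset.mem_image.1 hs
            obtain ⟨hτT, hpτ, _⟩ := Finset.mem_filter.1 hτ
            exact hrange i τ hτT hpτ)
          fun s hs _ => hy i s hs
    _ ≤ x i := hent i

/-- (ENT) with non-negative prices forces non-negative slot activities. [folklore] -/
theorem activity_nonneg_of_entropy {x : Fin n → ℝ} {y : Fin n → σ → ℝ} {Sh : Fin n → Finset σ}
    (hy : ∀ i, ∀ s ∈ Sh i, 0 ≤ y i s) (hent : ∀ i, ∑ s ∈ Sh i, y i s ≤ x i) : ∀ i, 0 ≤ x i :=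
  fun i => (Finset.sum_nonneg (hy i)).trans (hent i)

/-- FAITHFULNESS (i): the tautological profile `shape i τ = τ` is injective on fibres. [folklore] -/
theorem injOnFibres_id (Φ : SwitchOff T n) : InjOnFibres Φ (fun (_ : Fin n) (τ : ι) => τ) :=
  fun _ _ _ _ _ _ _ _ h => h

/-- FAITHFULNESS (ii): for strictly positive weights the tautological profile with the ACTUAL ratio as price satisfies
(EN) with equality. [folklore] -/
theorem pointwiseRatio_self (Φ : SwitchOff T n) {A : ι → ℝ} (hA : ∀ τ ∈ T, 0 < A τ) :
    PointwiseRatio Φ A (fun (_ : Fin n) (τ : ι) => τ) fun i τ => A τ / A (Φ.off i τ) := by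
  intro i τ hτ _
  exact le_of_eq (div_mul_cancel₀ (A τ) (hA _ (Φ.off_mem i τ hτ)).ne').symm

/-- FAITHFULNESS (iii): for strictly positive weights the single-slot clause gives back the FIBRE-restricted entropy
bound of the tautological profile — so `single_slot_of_pointwise_fibre` loses nothing, and the entire unprinted content of
the clause is the passage from context-dependent prices to the CONTEXT-FREE prices of `single_slot_of_pointwise`.
[folklore] -/
theorem fibreEntropy_of_single_slot [DecidableEq ι] (Φ : SwitchOff T n) {A : ι → ℝ} {x : Fin n → ℝ}
    (hA : ∀ τ ∈ T, 0 < A τ)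
    (h1 : ∀ i : Fin n, ∀ τ'' ∈ T, Φ.pend i τ'' = false →
      ∑ τ ∈ T with (Φ.pend i τ = true ∧ Φ.off i τ = τ''), A τ ≤ x i * A τ'') :
    ∀ i : Fin n, ∀ τ'' ∈ T, Φ.pend i τ'' = false →
      ∑ s ∈ (T.filter fun τ => Φ.pend i τ = true ∧ Φ.off i τ = τ'').image (fun τ => τ),
        A s / A (Φ.off i s) ≤ x i := by
  intro i τ'' hτ'' hp
  rw [Finset.image_id']
  have hpos : 0 < A τ'' := hA τ'' hτ''
  calc ∑ s ∈ T with (Φ.pend i s = true ∧ Φ.off i s = τ''), A s / A (Φ.off i s)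
      = ∑ s ∈ T with (Φ.pend i s = true ∧ Φ.off i s = τ''), A s / A τ'' :=
        Finset.sum_congr rfl fun s hs => by rw [(Finset.mem_filter.1 hs).2.2]
    _ = (∑ s ∈ T with (Φ.pend i s = true ∧ Φ.off i s = τ''), A s) / A τ'' := by rw [Finset.sum_div]
    _ ≤ x i := by rw [div_le_iff₀ hpos]; exact h1 i τ'' hτ'' hp

end Split

/-! ## §2 The U5 shape `PointDom` (pointwise form of `SlotDom`) and its liaisons -/

/-- **R3 IN POINTWISE FORM (HYPOTHESIS SHAPE; NOT PRINTED, NOT ASSERTED — `T4HistoryPeeling.SlotDom` with its last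
clause split into (INS) × (EN) × (ENT)).**  At each `(K, t)`, `|t| ≤ l₀`: a switch-off structure on `T K` whose bad class
IS `Bad K t`, slot activities `x` of total `≤ S K`, an insertion profile `shape` with values in the shape type `σ`,
context-free shape catalogues `Sh i` containing the shapes of the pending terms, prices `y ≥ 0` on them, the pointwise
ratio (EN) for the weights `A K t`, and the shape entropy `Σ_{s ∈ Sh i} y i s ≤ x i`.  DICTIONARY (the cell's reading of
[Balaban1989LargeFieldII], NOT a quotation): as for `SlotDom` (terms = large-field histories of one run after `K` steps,
slot = (birth scale, anchor cell), `off i` = delete the pending structure anchored at `i`); `shape i τ` = that structure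
as a combinatorial object relative to its anchor (cell sets of its regions at every scale of its life, renewal and merger
record); `y i s` = its context-free price — per creation the banked «exp(−p₀(g_j))» (p. 383), per cube the net of the
decay «exp(−½γ₀A₁²p₀²(g_j)(d′_j(Z_j^{(i)}) + 1) …)» and growth «exp O(1)|Z_j ∩ Ω_j|», «sup exp{Σ O(1)M^dR_j^{d+1}d′_j(Z_j)}»
factors of (1.79); `Sh i`, `x i` = the catalogue and activity of §3 / `T4HistoryPeeling` §4. [folklore] -/
structure PointDom {ι : Type*} [DecidableEq ι] (σ : Type*) (l₀ : ℝ) (T : ℕ → Finset ι) (A : ℕ → ℝ → ι → ℝ)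
    (Bad : ℕ → ℝ → Finset ι) (S : ℕ → ℝ) : Prop where
  /-- per `(K, t)`: switch-off structure, activities, profile, prices, catalogue; budget, bad class, (INS), catalogue
  membership, prices `≥ 0`, (EN), (ENT) -/
  dom : ∀ K t, |t| ≤ l₀ → ∃ (n : ℕ) (Φ : SwitchOff (T K) n) (x : Fin n → ℝ) (shape : Fin n → ι → σ)
      (y : Fin n → σ → ℝ) (Sh : Fin n → Finset σ),
    ∑ i, x i ≤ S K ∧ Bad K t = Φ.bad ∧ InjOnFibres Φ shape ∧
    (∀ i, ∀ τ ∈ T K, Φ.pend i τ = true → shape i τ ∈ Sh i) ∧ (∀ i, ∀ s ∈ Sh i, 0 ≤ y i s) ∧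
    PointwiseRatio Φ (A K t) shape y ∧ ∀ i, ∑ s ∈ Sh i, y i s ≤ x i

section Shapes

variable {ι : Type*} [DecidableEq ι] {σ σ' : Type*} {l₀ : ℝ} {T : ℕ → Finset ι} {A B : ℕ → ℝ → ι → ℝ}
  {Bad : ℕ → ℝ → Finset ι} {S : ℕ → ℝ}

/-- **`PointDom → SlotDom`** for non-negative weights: the E2 split recombined at every `(K, t)` (activities are
non-negative by (ENT), the single-slot clause by `single_slot_of_pointwise`). [folklore] -/
theorem PointDom.toSlotDom (h : PointDom σ l₀ T A Bad S) (hA : ∀ K t, |t| ≤ l₀ → ∀ τ ∈ T K, 0 ≤ A K t τ) :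
    SlotDom l₀ T A Bad S where
  dom K t ht := by
    classical
    obtain ⟨n, Φ, x, shape, y, Sh, hxS, hBad, hinj, hrange, hy, hen, hent⟩ := h.dom K t ht
    exact ⟨n, Φ, x, activity_nonneg_of_entropy hy hent, hxS, hBad,
      single_slot_of_pointwise Φ (hA K t ht) hinj hrange hy hen hent⟩

/-- `PointDom → PeierlsDom` (through `SlotDom` and the peeling theorem). [folklore] -/
theorem PointDom.toPeierlsDom (h : PointDom σ l₀ T A Bad S) (hA : ∀ K t, |t| ≤ l₀ → ∀ τ ∈ T K, 0 ≤ A K t τ) :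
    PeierlsDom l₀ T A Bad S :=
  (h.toSlotDom hA).toPeierlsDom hA

/-- One run: `Σ_{Bad} A ≤ (1 − e^{−S K}) · Σ_{T} A` at every `(K, t)`. [folklore] -/
theorem PointDom.bad_le (h : PointDom σ l₀ T A Bad S) (hA : ∀ K t, |t| ≤ l₀ → ∀ τ ∈ T K, 0 ≤ A K t τ) (K : ℕ)
    (t : ℝ) (ht : |t| ≤ l₀) : ∑ τ ∈ Bad K t, A K t τ ≤ (1 - Real.exp (-S K)) * ∑ τ ∈ T K, A K t τ :=
  (h.toSlotDom hA).bad_le hA K t ht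

/-- **THE LIAISON (pointwise R3 for both runs ⇒ NE7b's output shape)**: `PointDom` for run A and run B (shape types may
differ) with a common slot budget `S ≥ 0`, `Σ_K S K < ∞`, non-negative weights ⇒ `RelWeightBound l₀ T A B Bad
(K ↦ 1 − exp(−S K))`. [folklore] -/
theorem relWeightBound_of_pointDom (hS0 : ∀ K, 0 ≤ S K) (hS : Summable S)
    (hA : ∀ K t, |t| ≤ l₀ → ∀ τ ∈ T K, 0 ≤ A K t τ) (hB : ∀ K t, |t| ≤ l₀ → ∀ τ ∈ T K, 0 ≤ B K t τ)
    (hDA : PointDom σ l₀ T A Bad S) (hDB : PointDom σ' l₀ T B Bad S) :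
    RelWeightBound l₀ T A B Bad (fun K => 1 - Real.exp (-S K)) :=
  relWeightBound_of_slotDom hS0 hS hA hB (hDA.toSlotDom hA) (hDB.toSlotDom hB)

/-- **With the two-rate slot budget** — binder-for-binder `T4HistoryPeeling.relWeightBound_of_slotDom_twoRate` with
`PointDom` in place of `SlotDom`. [folklore] -/
theorem relWeightBound_of_pointDom_twoRate {C V r c : ℝ} (hC : 0 ≤ C) (hV : 0 ≤ V) (h0 : 0 < r) (h1 : r < 1)
    (hc : 0 < c) {jstar : ℕ → ℕ} (hfrac : ∀ K : ℕ, c * K ≤ ((K - jstar K : ℕ) : ℝ))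
    (hA : ∀ K t, |t| ≤ l₀ → ∀ τ ∈ T K, 0 ≤ A K t τ) (hB : ∀ K t, |t| ≤ l₀ → ∀ τ ∈ T K, 0 ≤ B K t τ)
    (hDA : PointDom σ l₀ T A Bad fun K => C * V * (r ^ (K - jstar K + 1) / (1 - r)))
    (hDB : PointDom σ' l₀ T B Bad fun K => C * V * (r ^ (K - jstar K + 1) / (1 - r))) :
    RelWeightBound l₀ T A B Bad fun K => 1 - Real.exp (-(C * V * (r ^ (K - jstar K + 1) / (1 - r)))) :=
  relWeightBound_of_slotDom_twoRate hC hV h0 h1 hc hfrac hA hB (hDA.toSlotDom hA) (hDB.toSlotDom hB)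

end Shapes

/-! ## §3 Entropy arithmetic: (ENT) from counting of the printed type (events × volume), the animal count, the
merger-tree count (nothing of Bałaban's is asserted — the readings in the docstrings are the cell's) -/

section Entropy

/-- **DOUBLY GRADED SHAPE SUM.**  Shapes `Sh` of one slot graded by an EVENT count `m s ≥ m₀` (R2: a structure pending
for `K − j` steps underwent `≥ m₀` renewals / mergers, `T4WeightBudget.card_Icc_le_of_windows`) and a VOLUME `v s ≥ v₀`
(cubes of all its regions; `v₀ = 1`), prices `y s ≤ ρ^{m s} · λ^{v s}` (R1: «exp(−p₀(g_j))» per creation, read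
`ρ = e^{−c_b p̄₀}`; per cube the net `λ` of the decay and growth factors of (1.79), small for small `g_j`; no sign condition
on `y`), and the JOINT COUNT `#{s ∈ Sh : m s = k, v s = w} ≤ Γ^k · C^w` (exponential in the volume — the printed type
«exp O(1)(MR_j)^{−d}|Z_j|» p. 383, in the kernel `card_animals_filter_le` for one region — and a constant per event: window
position, merger-tree shape `card_mergerTrees_le`, and the attachment entropy of later regions, which is exponential in the
CURRENT volume and hence, by the shrinking «d′_n(Z^{(n−j)}) ≤ 2^{−(n−j)}d′_j(Z)» p. 384 summed over the steps, exponential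
in the total volume: absorbed in `C^w` — cell reading, NOT kernel-proved).  Then
`Σ_{s ∈ Sh} y s ≤ (Γρ)^{m₀}/(1 − Γρ) · (Cλ)^{v₀}/(1 − Cλ)` whenever `Γρ < 1` and `Cλ < 1`: the slot activity of
`T4HistoryPeeling.recordSum_le` times a λ-small constant, ready for `pow_eventCount_le_twoRate` / `slotBudget_le`.
[folklore] -/
theorem gradedShapeSum_le {S : Type*} (Sh : Finset S) (m v : S → ℕ) (y : S → ℝ) {ρ lam Γ C : ℝ} (hρ : 0 ≤ ρ)
    (hlam : 0 ≤ lam) (hΓ : 0 ≤ Γ) (hC : 0 ≤ C) (hr : Γ * ρ < 1) (hl : C * lam < 1) {m₀ v₀ : ℕ}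
    (hy : ∀ s ∈ Sh, y s ≤ ρ ^ m s * lam ^ v s)
    (hcount : ∀ k w, ((Sh.filter fun s => m s = k ∧ v s = w).card : ℝ) ≤ Γ ^ k * C ^ w)
    (hm : ∀ s ∈ Sh, m₀ ≤ m s) (hv : ∀ s ∈ Sh, v₀ ≤ v s) :
    ∑ s ∈ Sh, y s ≤ (Γ * ρ) ^ m₀ / (1 - Γ * ρ) * ((C * lam) ^ v₀ / (1 - C * lam)) := by
  classical
  have hmaps : ∀ s ∈ Sh, (m s, v s) ∈ Sh.image fun s => (m s, v s) :=
    fun s hs => Finset.mem_image_of_mem (fun s => (m s, v s)) hs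
  have hfib : ∀ p : ℕ × ℕ, (Sh.filter fun s => (m s, v s) = p) = Sh.filter fun s => m s = p.1 ∧ v s = p.2 :=
    fun p => Finset.filter_congr fun s _ => Prod.ext_iff
  calc ∑ s ∈ Sh, y s = ∑ p ∈ Sh.image (fun s => (m s, v s)), ∑ s ∈ Sh with (m s, v s) = p, y s :=
        (Finset.sum_fiberwise_of_maps_to hmaps y).symm
    _ ≤ ∑ p ∈ Sh.image (fun s => (m s, v s)), ∑ s ∈ Sh with (m s, v s) = p, ρ ^ p.1 * lam ^ p.2 :=
        Finset.sum_le_sum fun p _ => Finset.sum_le_sum fun s hs => by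
          obtain ⟨hs', hps⟩ := Finset.mem_filter.1 hs
          rw [← hps]
          exact hy s hs'
    _ = ∑ p ∈ Sh.image (fun s => (m s, v s)),
          ((Sh.filter fun s => (m s, v s) = p).card : ℝ) * (ρ ^ p.1 * lam ^ p.2) :=
        Finset.sum_congr rfl fun p _ => by rw [Finset.sum_const, nsmul_eq_mul]
    _ ≤ ∑ p ∈ Sh.image (fun s => (m s, v s)), Γ ^ p.1 * C ^ p.2 * (ρ ^ p.1 * lam ^ p.2) :=
        Finset.sum_le_sum fun p _ =>
          mul_le_mul_of_nonneg_right (by rw [hfib p]; exact hcount p.1 p.2)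
            (mul_nonneg (pow_nonneg hρ _) (pow_nonneg hlam _))
    _ = ∑ p ∈ Sh.image (fun s => (m s, v s)), (Γ * ρ) ^ p.1 * (C * lam) ^ p.2 :=
        Finset.sum_congr rfl fun p _ => by rw [mul_pow, mul_pow]; ring
    _ ≤ ∑ p ∈ Sh.image m ×ˢ Sh.image v, (Γ * ρ) ^ p.1 * (C * lam) ^ p.2 :=
        Finset.sum_le_sum_of_subset_of_nonneg
          (fun p hp => by
            obtain ⟨s, hs, rfl⟩ := Finset.mem_image.1 hp
            exact Finset.mem_product.2 ⟨Finset.mem_image_of_mem m hs, Finset.mem_image_of_mem v hs⟩)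
          fun p _ _ => mul_nonneg (pow_nonneg (mul_nonneg hΓ hρ) _) (pow_nonneg (mul_nonneg hC hlam) _)
    _ = (∑ k ∈ Sh.image m, (Γ * ρ) ^ k) * ∑ w ∈ Sh.image v, (C * lam) ^ w := by
        rw [Finset.sum_product, Finset.sum_mul_sum]
    _ ≤ (Γ * ρ) ^ m₀ / (1 - Γ * ρ) * ((C * lam) ^ v₀ / (1 - C * lam)) :=
        mul_le_mul
          (sum_pow_le_of_le (mul_nonneg hΓ hρ) hr fun k hk => by
            obtain ⟨s, hs, rfl⟩ := Finset.mem_image.1 hk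
            exact hm s hs)
          (sum_pow_le_of_le (mul_nonneg hC hlam) hl fun w hw => by
            obtain ⟨s, hs, rfl⟩ := Finset.mem_image.1 hw
            exact hv s hs)
          (Finset.sum_nonneg fun w _ => pow_nonneg (mul_nonneg hC hlam) _)
          (div_nonneg (pow_nonneg (mul_nonneg hΓ hρ) _) (sub_nonneg.2 hr.le))

/-- **THE VOLUME-COUNT TYPE IS THE TREE'S ANIMAL THEOREM.**  For a finite family `𝒴` of `R`-connected cell sets through
a cell `q` (neighbour lists `nbr` of size `≤ Δ`): at most `((Δ+1)²)^w` members have exactly `w` cells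
(`Literature.Probability.LatticeModels.card_connectedFamily_le` gives `(Δ+1)^{2(w−1)}` for `w ≥ 1`; none has `0` cells).
This is the `C^w` of `gradedShapeSum_le` for a structure with ONE region; several regions multiply (one anchored animal
per creation). [folklore] -/
theorem card_animals_filter_le {V : Type*} [DecidableEq V] {R : V → V → Prop} {nbr : V → Finset V} {Δ : ℕ}
    (hR : ∀ x y, R x y → R y x) (hΔ : ∀ x, (nbr x).card ≤ Δ) (hnbr : ∀ x y, R x y → y ∈ nbr x) (q : V)
    (𝒴 : Finset (Finset V)) (h𝒴 : ∀ Y ∈ 𝒴, q ∈ Y ∧ IsRConnected R Y) (w : ℕ) :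
    ((𝒴.filter fun Y => Y.card = w).card : ℝ) ≤ (((Δ : ℝ) + 1) ^ 2) ^ w := by
  have hΔ1 : (1 : ℝ) ≤ (Δ : ℝ) + 1 := by
    have := (Nat.cast_nonneg Δ : (0 : ℝ) ≤ Δ)
    linarith
  rcases w with _ | w'
  · have hempty : (𝒴.filter fun Y => Y.card = 0) = ∅ := by
      refine Finset.filter_eq_empty_iff.2 fun Y hY h0 => ?_
      have hpos : 0 < Y.card := Finset.card_pos.2 ⟨q, (h𝒴 Y hY).1⟩
      omega
    rw [hempty, Finset.card_empty, Nat.cast_zero, pow_zero]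
    exact zero_le_one
  · have hnat : (𝒴.filter fun Y => Y.card = w' + 1).card ≤ (Δ + 1) ^ (2 * w') := by
      refine card_connectedFamily_le hR hΔ hnbr q w' _ fun Y hY => ?_
      obtain ⟨hY𝒴, hcard⟩ := Finset.mem_filter.1 hY
      obtain ⟨hq, -, hconn⟩ := h𝒴 Y hY𝒴
      exact ⟨hq, hcard.le, fun x hx => hconn q hq x hx⟩
    calc ((𝒴.filter fun Y => Y.card = w' + 1).card : ℝ) ≤ ((Δ : ℝ) + 1) ^ (2 * w') := by
          exact_mod_cast hnat
      _ ≤ (((Δ : ℝ) + 1) ^ 2) ^ (w' + 1) := by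
          rw [← pow_mul]
          exact pow_le_pow_right₀ hΔ1 (by omega)

/-- **THE MERGER-TREE COUNT.**  The merger history of a structure built from `e + 1` separately born pieces is a binary
tree with `e` internal nodes; there are `catalan e ≤ 4^e` of them (Mathlib: `BinaryTree.treesOfNumNodesEq_card_eq_catalan`,
`succ_mul_catalan_eq_centralBinom`, `Nat.centralBinom_le_four_pow`) — one constant factor per event, into `Γ`. [folklore] -/
theorem card_mergerTrees_le (e : ℕ) : ((BinaryTree.treesOfNumNodesEq e).card : ℝ) ≤ 4 ^ e := by
  rw [BinaryTree.treesOfNumNodesEq_card_eq_catalan]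
  have h : catalan e ≤ 4 ^ e :=
    (Nat.le_mul_of_pos_left (catalan e) (Nat.succ_pos e)).trans
      ((succ_mul_catalan_eq_centralBinom e).le.trans (Nat.centralBinom_le_four_pow e))
  exact_mod_cast h

end Entropy

/-! ## §4 Sanity: the independent-structure model carries the one-point profile with (EN) an equality -/

section Product

variable {n : ℕ}

/-- **`PointDom` IS INHABITED NON-TRIVIALLY**: in the independent-structure model of `T4HistoryPeeling` §5 (patterns
`Fin n → Bool`, weights `a₀ · ∏_{i on} u K i`, `u ≥ 0`) take the ONE-POINT profile `σ = Unit`, price `y i () = u K i`,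
catalogue `{()}`: (INS) holds because a pattern with slot `i` on is its switch-off with bit `i` set, (EN) holds with
EQUALITY (`productWeight_update_true`), (ENT) with equality, budget `S K = Σ_i u K i`. [folklore] -/
theorem pointDom_product (l₀ a₀ : ℝ) (u : ℕ → Fin n → ℝ) (hu : ∀ K i, 0 ≤ u K i) :
    PointDom Unit l₀ (fun _ => (Finset.univ : Finset (Fin n → Bool))) (fun K _ τ => productWeight a₀ (u K) τ)
      (fun _ _ => (productSwitchOff n).bad) fun K => ∑ i, u K i where
  dom K _ _ := by
    refine ⟨n, productSwitchOff n, u K, fun _ _ => (), fun i _ => u K i, fun _ => {()}, le_rfl, rfl, ?_,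
      fun _ _ _ _ => Finset.mem_singleton_self _, fun i _ _ => hu K i, ?_, fun i => by simp⟩
    · -- (INS): a pattern with slot `i` on is determined by its switch-off
      intro i τ₁ _ τ₂ _ h₁ h₂ hoff _
      change τ₁ i = true at h₁
      change τ₂ i = true at h₂
      change Function.update τ₁ i false = Function.update τ₂ i false at hoff
      funext j
      by_cases hj : j = i
      · subst hj
        rw [h₁, h₂]
      · have hj' := congr_fun hoff j
        rwa [Function.update_of_ne hj, Function.update_of_ne hj] at hj'
    · -- (EN) with equality
      intro i τ _ hτ
      change τ i = true at hτ
      change productWeight a₀ (u K) τ ≤ u K i * productWeight a₀ (u K) (Function.update τ i false)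
      have hupd : Function.update (Function.update τ i false) i true = τ := by
        rw [Function.update_idem, ← hτ, Function.update_eq_self]
      have h := productWeight_update_true (a₀ := a₀) (u := u K) (τ := Function.update τ i false) (i := i) (by simp)
      rw [hupd] at h
      exact h.le

end Product

end Literature.MathematicalPhysics.QuantumFieldTheory.Balaban1983to89.T4InsertionProfile
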